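import Summits.CriticalPhenomena.PercolationContinuityZ3.Theorems.Transplant.SkelPhiCylinderTails
import Summits.CriticalPhenomena.PercolationContinuityZ3.Theorems.Transplant.SkelRimDeep
import HarnessLib

/-!
# D″ node, STRUCTURE-FREE layer L4′.2 (SHEAR-SCOPE §3.14 ruling (B″), V98 p3 column): the FAT RADIUS `Skelφ.fatRadius hfr hC`, UNIFORM over the
# base vertices, the FAT PRISM SEQUENCE `fatSeq t n = cylBall t n (ψ n)` with its level axioms (monotone, margin, exhausting), and the rim / deep
# dichotomy of φ-level kit regions — φ-level re-cut of `SkelFatRadius` and of the two skeleton-typed lemmas of `SkelRimDeep`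

builds on p205010 (kernel theorem, internal audit signed; external expert review pending) — nothing in this file uses p205010.
Lane `prim-bschramm`, seat `prim-bschramm-p3` (gen 7; design owner, V98 p3 column); helper file (`--supports stmt-CriticalPhenomena-4575`).
Hypotheses through the dictionary (`SkelPhiCylBall` §0, `SkelPhiCylinderTails` §2): `hfr : Skelφ.Frames G φ types` and Φ2 `hC : Skelφ.CylSubcritical G φ types p`
for the radius; `hlip : Skelφ.Lip G φ` for the margin; `hκ : Skelφ.CylConn G φ types` for exhaustion.  The φ-free `Skel.deep_or_far` is imported.
* §1 `exists_fatStep`, `biUnion_cylReach_antitone`, `exists_ufatStep` (one radius for all base vertices);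
* §2 **`fatRadius hfr hC : ℕ → ℕ`** (`ψ 0 = 0`, `ψ (n+1) = max (ψ n + 1) (R_{n+1} + 1)`), `fatRadius_succ_ge/_mono`, `le_fatRadius`, **`prob_cylReach_fat_le`**
  (at every `t ∈ types`: induced exits at level `n+1` from `cylBall t n (ψ n)` beyond radius `ψ(n+1) − 1` have probability `≤ 2^{-(n+1)}`);
* §3 **`fatSeq hfr hC t n := cylBallFin t n (ψ n)`** (any centre), `mem_fatSeq_iff`, `fatSeq_monotone`, **`fatSeq_nest`** (`Lip`), **`fatSeq_exhaust`** (`CylConn`, `t ∈ types`),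
  `fatSeq_subset_cyl`;
* §4 `prismAt_deep_or_far`, `cylBall_deep_or_far` (the kit region behind a contact is deep or far — pure triangle inequality).
[cite: KozmaNitzan2024, §4 Lemma 9 (p. 16: the scale M), p. 21, Lemma 12 p. 24 — the ℤ^d model] [cite: GrimmettPercolation1999, §7.2 (7.14)–(7.16)]
[cite: MartineauSevero2019, Cor. 2.2]
-/

noncomputable section

open MeasureTheory Filter ProbabilityTheory
open scoped Topology ENNReal

namespace Summit.CriticalPhenomena.PercolationContinuityZ3.Theorems.Transplant

namespace Skelφ

open Literature.Probability.Percolation Literature.Probability.LatticeModels SimpleGraph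
open Literature.Probability.Percolation.GM
open Literature.Barriers.CriticalPhenomena (graphBall graphBall_finite mem_graphBall_self graphBall_mono mem_graphBall_map)

variable {V : Type} {G : SimpleGraph V} [G.LocallyFinite] {φ : V → Site 2} {types : Finset V}

/-! ## §1 One step of the fat radius, uniform over the base vertices -/

/-- One step of the fat radius at ONE centre: some `R` beyond which the induced exits at level `n + 1` from `cylBall t n r` have probability
`≤ 2^{-(n+1)}`. [folklore] -/
theorem exists_fatStep [Countable V] (hfr : Frames G φ types) {p : unitInterval} (hC : CylSubcritical G φ types p) (t : V) (r n : ℕ) :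
    ∃ R : ℕ, (bondPercolation G p).real (⋃ a ∈ cylBallFin G φ t n r, cylReach G φ t (n + 1) R a) ≤ (1 / 2 : ℝ) ^ (n + 1) :=
  exists_prob_cylReach_biUnion_le hfr hC _
    (fun a ha => cylBall_subset_cyl G φ t (n + 1) r (cylBall_mono G φ t (Nat.le_succ n) le_rfl ((mem_cylBallFin G φ).1 ha))) (by positivity)

omit [G.LocallyFinite] in
variable (G φ) in
/-- The union of the exit events decreases in the radius. [folklore] -/
theorem biUnion_cylReach_antitone (t : V) (n : ℕ) (A : Finset V) : Antitone fun R => ⋃ a ∈ A, cylReach G φ t n R a :=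
  fun _ _ h => Set.iUnion₂_mono fun a _ => cylReach_antitone G φ t n a h

/-- **One step of the fat radius, UNIFORM over the base vertices** (finitely many types; the events decrease in the radius). [folklore] -/
theorem exists_ufatStep [Countable V] (hfr : Frames G φ types) {p : unitInterval} (hC : CylSubcritical G φ types p) (r n : ℕ) :
    ∃ R : ℕ, ∀ t ∈ types, (bondPercolation G p).real (⋃ a ∈ cylBallFin G φ t n r, cylReach G φ t (n + 1) R a) ≤ (1 / 2 : ℝ) ^ (n + 1) := by
  have h : ∀ t ∈ types, ∃ R : ℕ, (bondPercolation G p).real (⋃ a ∈ cylBallFin G φ t n r, cylReach G φ t (n + 1) R a) ≤ (1 / 2 : ℝ) ^ (n + 1) :=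
    fun t _ => exists_fatStep hfr hC t r n
  choose! R hR using h
  refine ⟨types.sup R, fun t ht => le_trans (measureReal_mono ?_ (measure_ne_top _ _)) (hR t ht)⟩
  exact biUnion_cylReach_antitone G φ t (n + 1) _ (Finset.le_sup ht)

/-! ## §2 The fat radius -/

/-- **The fat radius** `ψ` of the fat prisms, uniform over the base vertices (depends on `p` through Φ2): `ψ 0 = 0`,
`ψ (n+1) = max (ψ n + 1) (R_{n+1} + 1)` with `R_{n+1}` from `exists_ufatStep` for the sources `cylBall t n (ψ n)`, `t ∈ types`.
[cite: KozmaNitzan2024, §4 p. 16 (Lemma 9: the scale M)] -/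
def fatRadius [Countable V] (hfr : Frames G φ types) {p : unitInterval} (hC : CylSubcritical G φ types p) : ℕ → ℕ
  | 0 => 0
  | n + 1 => max (fatRadius hfr hC n + 1) (Classical.choose (exists_ufatStep hfr hC (fatRadius hfr hC n) n) + 1)

/-- The fat radius grows by at least one per level. [folklore] -/
theorem fatRadius_succ_ge [Countable V] (hfr : Frames G φ types) {p : unitInterval} (hC : CylSubcritical G φ types p) (n : ℕ) :
    fatRadius hfr hC n + 1 ≤ fatRadius hfr hC (n + 1) := by
  change fatRadius hfr hC n + 1 ≤ max _ _
  exact le_max_left _ _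

/-- The fat radius is monotone. [folklore] -/
theorem fatRadius_mono [Countable V] (hfr : Frames G φ types) {p : unitInterval} (hC : CylSubcritical G φ types p) :
    Monotone (fatRadius hfr hC) := by
  refine monotone_nat_of_le_succ fun n => ?_
  have := fatRadius_succ_ge hfr hC n; omega

/-- `n ≤ ψ n`. [folklore] -/
theorem le_fatRadius [Countable V] (hfr : Frames G φ types) {p : unitInterval} (hC : CylSubcritical G φ types p) (n : ℕ) :
    n ≤ fatRadius hfr hC n := by
  induction n with
  | zero => exact Nat.zero_le _
  | succ n ih => have := fatRadius_succ_ge hfr hC n; omega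

/-- **The defining estimate of the fat radius** (at every base vertex): induced exits at level `n + 1` from `cylBall t n (ψ n)` beyond radius
`ψ(n+1) − 1` have probability `≤ 2^{-(n+1)}`. [folklore] -/
theorem prob_cylReach_fat_le [Countable V] (hfr : Frames G φ types) {p : unitInterval} (hC : CylSubcritical G φ types p) {t : V}
    (ht : t ∈ types) (n : ℕ) :
    (bondPercolation G p).real
      (⋃ a ∈ cylBallFin G φ t n (fatRadius hfr hC n), cylReach G φ t (n + 1) (fatRadius hfr hC (n + 1) - 1) a) ≤ (1 / 2 : ℝ) ^ (n + 1) := by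
  have hspec := Classical.choose_spec (exists_ufatStep hfr hC (fatRadius hfr hC n) n) t ht
  set R := Classical.choose (exists_ufatStep hfr hC (fatRadius hfr hC n) n) with hR
  have hle : R ≤ fatRadius hfr hC (n + 1) - 1 := by
    have : R + 1 ≤ fatRadius hfr hC (n + 1) := by
      change R + 1 ≤ max _ _; exact le_max_right _ _
    omega
  refine le_trans (measureReal_mono ?_ (measure_ne_top _ _)) hspec
  exact Set.iUnion₂_mono fun a _ => cylReach_antitone G φ t (n + 1) a hle

/-! ## §3 The fat prism sequence -/

/-- **The fat prism sequence** `Λ^fat_n(t) = cylBall t n (ψ n)` (any centre `t`). [cite: KozmaNitzan2024, §4 p. 16 (Lemma 9)] -/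
def fatSeq [Countable V] (hfr : Frames G φ types) {p : unitInterval} (hC : CylSubcritical G φ types p) (t : V) (n : ℕ) : Finset V :=
  cylBallFin G φ t n (fatRadius hfr hC n)

/-- Membership in the fat prism. [folklore] -/
theorem mem_fatSeq_iff [Countable V] (hfr : Frames G φ types) {p : unitInterval} (hC : CylSubcritical G φ types p) {t : V} {n : ℕ} {v : V} :
    v ∈ fatSeq hfr hC t n ↔ v ∈ cylBall G φ t n (fatRadius hfr hC n) :=
  mem_cylBallFin G φ

/-- The fat prisms increase. [folklore] -/
theorem fatSeq_monotone [Countable V] (hfr : Frames G φ types) {p : unitInterval} (hC : CylSubcritical G φ types p) (t : V) :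
    Monotone (fatSeq hfr hC t) := by
  intro n n' h v hv
  rw [mem_fatSeq_iff] at hv ⊢
  exact cylBall_mono G φ t h (fatRadius_mono hfr hC h) hv

/-- **Margin** (from `Lip`): the outer boundary of a fat prism lies in the next one (a neighbour of `cylBall t n (ψ n)` has skeleton coordinate in
`Λ_{n+1}`, and induced distance `≤ ψ n + 1 ≤ ψ (n+1)` in the larger cylinder). [folklore] -/
theorem fatSeq_nest [DecidableEq V] [Countable V] (hlip : Lip G φ) (hfr : Frames G φ types) {p : unitInterval}
    (hC : CylSubcritical G φ types p) (t : V) (n : ℕ) : outerBoundary G (fatSeq hfr hC t n) ⊆ fatSeq hfr hC t (n + 1) := by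
  intro v hv
  rw [outerBoundary, Finset.mem_sdiff, Finset.mem_biUnion] at hv
  obtain ⟨⟨w, hw, hvw⟩, -⟩ := hv
  rw [SimpleGraph.mem_neighborFinset] at hvw
  rw [mem_fatSeq_iff] at hw ⊢
  -- `v` lies in the cylinder of half-width `n + 1`
  have hvc : v ∈ cyl φ t (n + 1) := by
    have hwc := cylBall_subset_cyl G φ t n _ hw
    rw [mem_cyl, mem_box] at hwc ⊢
    intro i
    have h1 := hwc i
    have h2 := hlip hvw i
    simp only [Pi.sub_apply] at h1 ⊢
    rw [abs_le] at h2
    constructor <;> push_cast <;> linarith [h1.1, h1.2, h2.1, h2.2]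
  exact cylBall_mono G φ t le_rfl (fatRadius_succ_ge hfr hC n) (mem_cylBall_succ_of_adj G φ t (Nat.le_succ n) hw hvw hvc)

/-- **Exhaustion** (from (κ)): every vertex lies in some fat prism about a BASE vertex `t`. [folklore] -/
theorem fatSeq_exhaust [Countable V] (hκ : CylConn G φ types) (hfr : Frames G φ types) {p : unitInterval} (hC : CylSubcritical G φ types p)
    {t : V} (ht : t ∈ types) (v : V) : ∃ n, v ∈ fatSeq hfr hC t n := by
  -- a cylinder of half-width `m ≥ 1` containing `v`
  set m : ℕ := (φ v 0 - φ t 0).natAbs + (φ v 1 - φ t 1).natAbs + 1 with hm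
  have hvm : v ∈ cyl φ t m := by
    rw [mem_cyl, mem_box]
    intro i
    simp only [Pi.sub_apply]
    have ha0 := le_abs_self (φ v 0 - φ t 0); have ha0' := neg_abs_le (φ v 0 - φ t 0)
    have ha1 := le_abs_self (φ v 1 - φ t 1); have ha1' := neg_abs_le (φ v 1 - φ t 1)
    have hb0 := abs_nonneg (φ v 0 - φ t 0); have hb1 := abs_nonneg (φ v 1 - φ t 1)
    fin_cases i <;> constructor <;> simp only [hm] <;> push_cast <;> linarith
  -- a walk in the induced cylinder, by (κ)
  obtain ⟨wk⟩ := (hκ.connected ht (by omega : 1 ≤ m)).preconnected ⟨t, self_mem_cyl φ t m⟩ ⟨v, hvm⟩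
  refine ⟨max m wk.length, (mem_fatSeq_iff hfr hC).2 ?_⟩
  refine cylBall_mono G φ t (le_max_left _ _) ((le_max_right _ _).trans (le_fatRadius hfr hC _)) ?_
  exact ⟨⟨v, hvm⟩, ⟨wk, le_rfl⟩, rfl⟩

/-- Fat prisms lie in their cylinder. [folklore] -/
theorem fatSeq_subset_cyl [Countable V] (hfr : Frames G φ types) {p : unitInterval} (hC : CylSubcritical G φ types p) (t : V) (n : ℕ) :
    (↑(fatSeq hfr hC t n) : Set V) ⊆ cyl φ t n := fun _ hv =>
  cylBall_subset_cyl G φ t n _ ((mem_fatSeq_iff hfr hC).1 (Finset.mem_coe.1 hv))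

/-! ## §4 The kit region behind a contact is deep or far (no retraction; pure triangle inequality) -/

omit [G.LocallyFinite] in
/-- **The kit region behind a contact is deep or far**: for radii `ψℓ + nF ≤ L' ≤ R`, either the route region `prismAt x ψℓ A` lies in `B_G(w₀, R)`,
or every vertex of the kit region `prismAt x nF B` lies outside `B_G(w₀, R − L')`. [cite: KozmaNitzan2024, §4 p. 21, Lemma 12 p. 24] -/
theorem prismAt_deep_or_far {w₀ : V} {R nF ψℓ L' : ℕ} (x : V) (hL : ψℓ + nF ≤ L') (hLR : L' ≤ R) (A B : Set (Site 2)) :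
    prismAt G φ x ψℓ A ⊆ graphBall G w₀ R ∨ ∀ u ∈ prismAt G φ x nF B, u ∉ graphBall G w₀ (R - L') := by
  rcases Skel.deep_or_far G (nF := nF) x hL hLR with h | h
  · exact Or.inl fun u hu => h hu.1
  · exact Or.inr fun u hu hu' => Set.disjoint_left.1 h hu.1 hu'

omit [G.LocallyFinite] in
/-- The same with the FAT kit region `cylBall x n nF`. [cite: KozmaNitzan2024, §4 p. 21, Lemma 12 p. 24] -/
theorem cylBall_deep_or_far {w₀ : V} {R nF ψℓ L' : ℕ} (x : V) (hL : ψℓ + nF ≤ L') (hLR : L' ≤ R) (n m : ℕ) :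
    cylBall G φ x m ψℓ ⊆ graphBall G w₀ R ∨ ∀ u ∈ cylBall G φ x n nF, u ∉ graphBall G w₀ (R - L') := by
  rcases Skel.deep_or_far G (nF := nF) x hL hLR with h | h
  · exact Or.inl fun u hu => h (cylBall_subset_prism G φ x m ψℓ hu).1
  · exact Or.inr fun u hu hu' => Set.disjoint_left.1 h (cylBall_subset_prism G φ x n nF hu).1 hu'

end Skelφ

end Summit.CriticalPhenomena.PercolationContinuityZ3.Theorems.Transplant

end
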